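import Mathlib
import HarnessLib

/-!
# W78LogMeasure

Topic `Literature/Uncategorized`. Named literature fact(s) relocated by the gate from `Summits/Schanuel/Schanuel/Theorems/RootDecomp1KHyper02.lean`
(accept-time relocation of `[cite]`d propositions written inline in a Summits proposal; human ruling 2026-08-15).
Sources: Waldschmidt1978.

* `Literature.Uncategorized.W78LogMeasure`
-/

namespace Literature.Uncategorized

open Complex IntermediateField Filter Polynomial

/-- **Vendored named fact, HYPOTHESIS ONLY — Waldschmidt 1978, COROLLARY 3.7** (p. 454; Cijsouw's
measure, new proof): for a non-zero algebraic `α` and any non-zero determination `λ` of `log α`,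
«a transcendence measure for `log α` is `2 C₁₅(α) N² (Log H + N Log N)(1 + Log N)⁻¹`»,
`C₁₅(α) = 2^38 d³ V (1 + Log d + Log V)` (p. 454); here with the constant existential, `N ≥ 1`,
`H ≥ 16`, `>` weakened to `≥`.  NOT a Literature fact yet (cite request filed); hypothesis `hlm`
only. [cite: Waldschmidt1978, Cor. 3.7] -/
def W78LogMeasure : Prop :=
  ∀ lam : ℂ, lam ≠ 0 → IsAlgebraic ℚ (Complex.exp lam) → ∃ C : ℝ, 0 < C ∧
    ∀ (P : Polynomial ℤ) (N H : ℕ), P ≠ 0 → 1 ≤ N → P.natDegree ≤ N → 16 ≤ H →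
      (∀ k, |P.coeff k| ≤ (H : ℤ)) →
      Real.exp (-(C * (N : ℝ) ^ 2 * (Real.log H + N * Real.log N) / (1 + Real.log N))) ≤
        ‖Polynomial.aeval lam P‖

end Literature.Uncategorized
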